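import Summits.QuantumFields.BalabanUV.T4Continuum.Support.OutputRateTowerInstance

/-!
# Spine/NE5/LeafIndex — the TYPER's leaf index of row NE5 (node U3), route P1 «input-interpolation Cauchy rate»:
# the leaf ids L01–L12 (+ L07r ∕ L08r ∕ L08e) of `HOME/t4/formal/NE5/DAG.md` as TRANSPARENT ABBREVIATIONS of the tree's
# hypothesis shapes over an ABSTRACT step model, and the bookkeeping faces «leaves ⟹ NE5» BY NAME

Cell `pub-balaban`, T⁴-continuum fan-out, spine row NE5, formalisation swarm `t4-ne5-formalise-*`, unit
`b2b-balaban-t4-ne5-formalise-typer` (gen 1).  Skeleton of record `HOME/t4/b2b-balaban-t4-ne5-p1/SKELETON-NE5-P1.md`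
(sha16 1d962bb8f3583a17, acknowledged by t4-ref2 pass 58, trigger `t4/T4-NE5-TRIGGER.json`).

WHAT THIS FILE IS.  Vocabulary + a kernel re-check, NOTHING ELSE: (i) for an abstract `M : StepModel C Op Hist` every leaf id of
the DAG is an `abbrev` whose body is the tree shape BY NAME (`L01 M EA W := M.RepresentsA EA W`, …) — no content is restated,
no `Prop` fact is minted for a W2 ∕ W2-ins ∕ W3 envelope or for row NE2's `PerturbationLaws` (trigger c3: they stay DISPLAYED
binders; here they are displayed under their leaf ids and unfold by `rfl`); (ii) the bookkeeping faces `ne5_of_leaves` (= the Data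
leaf's `StepModel.ne5_at_of_stepModel_lip_nat`, END face E1), `ne5_of_leaves_fibre` (= `…_fibre_scale_nat`, E1′: every wall in
its most primitive typed form) and `ne5_of_leaves_perturbed` (= `OutputRateTowerInstance.ne5_at_of_perturbed_split_readsIns_nat`,
E5: W1 ∕ W4 PRODUCED, row NE2's tower inputs and row NE3's `LocalRate` displayed) restate the END faces with the binders
NAMED BY LEAF ID, so that the referee's check «the binder list maps one-to-one onto the leaf table, no binder unaccounted» is a
kernel fact: each proof is the END face applied to the binders in order, and nothing else.

WHAT THIS FILE IS NOT.  Not an instance: the swarm's work rows O1-a…f ∕ O4-r ∕ O6-n (the owner's claim table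
`t4/b2b-balaban-t4-ne5-p1/O1-CLAIM-TABLE-NE5-P1.md`) construct `B13Step : StepModel b13Carriers OpDatum HistDatum` and prove
`L01 B13Step EA W`, … under `T4Continuum/Support/`; a row counts landed only when a tree lemma's CONCLUSION is the leaf's shape
for that model (c5: «NE5 leaf <id> instantiated for <species>», never «NE5 proved»).  Leaf seats may use these ids or the
tree names directly — they are the same terms.

HONEST FRAMING.  NE5 is NOT IN PRINT (cell GAPS G-t4-U3-1) and NOT PROVED; 0∕12 leaves are instantiated on Bałaban's objects;
the O2 operator half ∕ O3 ∕ O5 need mathematics not in print (c6, WALL).  Rung (B)+1 bookkeeping on a FIXED finite T⁴ — NOT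
the continuum limit by itself, NOT infinite volume, NOT a mass gap, NOT Clay.  Spine PROVED 0∕9.  HONEST DEPENDENCY: continuum
YM on T⁴ ⇐ BetaPertH ∧ nine spine estimates (0/9 proved); BetaPertH ⇐ (D1) ∧ (D4) ∧ CAP+tail; G-an2-4 gates asym, D1 and
NE2/3/4.  0 sorry; axioms standard; 0 cite tags (nothing printed is asserted); imports `Support/OutputRateTowerInstance` only.
-/

noncomputable section

open Set Metric
open scoped Matrix Matrix.Norms.L2Operator

namespace Summit.QuantumFields.BalabanUV.T4Continuum.Spine.NE5

open Literature.MathematicalPhysics.QuantumFieldTheory.Balaban1983to89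
open Literature.MathematicalPhysics.QuantumFieldTheory.Balaban1983to89.T4OutputRate
open Literature.MathematicalPhysics.QuantumFieldTheory.Balaban1983to89.T4InputCauchyRateData
open Literature.MathematicalPhysics.QuantumFieldTheory.Balaban1983to89.T4EtaRateMin
open Summit.QuantumFields.BalabanUV.T4Continuum.CovariantAveragingTower
open Summit.QuantumFields.BalabanUV.T4Continuum.BackgroundResolventTower
open Summit.QuantumFields.BalabanUV.T4Continuum.OutputRateInsertion
open Summit.QuantumFields.BalabanUV.T4Continuum.OutputRateTowerSocket
open Summit.QuantumFields.BalabanUV.T4Continuum.OutputRateTowerInstance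

/-! ## §1 The leaf ids (DAG.md §1B) as transparent abbreviations of the tree shapes -/

section LeafIds

variable {C : Carriers} {Op Hist : Type*} [NormedAddCommGroup Op] [NormedSpace ℂ Op] [NormedAddCommGroup Hist]
  [NormedSpace ℂ Hist] (M : StepModel C Op Hist)

/-- L01 (MI-R-A, IDENTIFICATION): run A's outputs ARE the step map at run A's data — `StepModel.RepresentsA` BY NAME.
Instantiated by work row O1-e. [folklore] -/
abbrev L01 (EA : Functional C C.BgA) (W : Set (ℕ → ℝ)) : Prop := M.RepresentsA EA W

/-- L02 (MI-R-B, IDENTIFICATION): `StepModel.RepresentsB` BY NAME.  Row O1-e. [folklore] -/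
abbrev L02 (EB : Functional C C.BgB) (W : Set (ℕ → ℝ)) : Prop := M.RepresentsB EB W

/-- L03 (MI-R-base, MEMBERSHIP): run B's data lie in the admissible base — `StepModel.InBase` BY NAME.  Row O1-f. [folklore] -/
abbrev L03 (EB : Functional C C.BgB) (W : Set (ℕ → ℝ)) : Prop := M.InBase EB W

/-- L04 (W2, ONE-RUN REGULARITY, displayed binder — c3): `StepModel.DataLipschitz` BY NAME; produced from `L04op ∧ L04hist` by
`StepModel.dataLipschitz_of_fibreEnvelopes` with `Λ = G/(1 − ρ₀)`.  Operator half = O2-op (WALL, c6); history half = O2-hist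
(structural via `T4InputCauchyRateTermwise.TermHistExpLinear`). [folklore] -/
abbrev L04 (W : Set (ℕ → ℝ)) (κ Λ ρ₀ : ℝ) : Prop := M.DataLipschitz W κ Λ ρ₀

/-- L04op (W2 operator fibre, displayed binder — c3, WALL c6): `StepModel.OpFibreEnvelope` BY NAME. [folklore] -/
abbrev L04op (W : Set (ℕ → ℝ)) (κ G : ℝ) : Prop := M.OpFibreEnvelope W κ G

/-- L04hist (W2 history fibre, displayed binder — c3): `StepModel.HistFibreEnvelope` BY NAME. [folklore] -/
abbrev L04hist (W : Set (ℕ → ℝ)) (κ G : ℝ) : Prop := M.HistFibreEnvelope W κ G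

/-- L05 (levels A, QUOTED LEAF — locator [Balaban1987RG1] (0.25) p. 257 ∕ (1.18) p. 263 on the SHAPE only, c4):
`T4OutputRate.DecayBound EA W EA₀ κ` BY NAME. [folklore] -/
abbrev L05 (EA : Functional C C.BgA) (W : Set (ℕ → ℝ)) (EA₀ κ : ℝ) : Prop := DecayBound EA W EA₀ κ

/-- L06 (levels B, QUOTED LEAF as L05): `DecayBound EB W E₀ κ` BY NAME. [folklore] -/
abbrev L06 (EB : Functional C C.BgB) (W : Set (ℕ → ℝ)) (E₀ κ : ℝ) : Prop := DecayBound EB W E₀ κ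

/-- L07 (W1, INPUT RATE = row NE2's object): `StepModel.OperatorRate` BY NAME; PRODUCED by
`OutputRateTowerInstance.operatorRate_of_perturbed_floor` from row NE2's theorem + L12 + L07r + the margin floor. [folklore] -/
abbrev L07 (W : Set (ℕ → ℝ)) (δ θ : ℝ) : Prop := M.OperatorRate W δ θ

/-- L08 (W4, RATE OF INSERTION MAPS): `StepModel.InsertionRate` BY NAME; PRODUCED by
`OutputRateInsertion.insertionRate_of_operatorRate` from L07 ∧ L08r ∧ L08e ∧ reach. [folklore] -/
abbrev L08 (W : Set (ℕ → ℝ)) (κ E₀ δ' θ : ℝ) : Prop := M.InsertionRate W κ E₀ δ' θ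

/-- L08r (reading-ins, IDENTIFICATION): `OutputRateInsertion.InsOpModel.ReadsIns (InsOpModel.ofStep M Ins) W` BY NAME.  Row O4-r.
[folklore] -/
abbrev L08r (Ins : ℕ → Op → (C.Dom → ℝ) → Hist) (W : Set (ℕ → ℝ)) : Prop := (InsOpModel.ofStep M Ins).ReadsIns W

/-- L08e, envelope half (W2-ins, ONE-RUN REGULARITY, displayed binder — c3): `InsOpModel.InsOpEnvelope` BY NAME. [folklore] -/
abbrev L08env (Ins : ℕ → Op → (C.Dom → ℝ) → Hist) (W : Set (ℕ → ℝ)) (κ E₀ Gi : ℝ) : Prop :=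
  (InsOpModel.ofStep M Ins).InsOpEnvelope W κ E₀ Gi

/-- L08e, first-scales half (one-run size of the insertion): `InsOpModel.InsBoundA` BY NAME. [folklore] -/
abbrev L08bdA (Ins : ℕ → Op → (C.Dom → ℝ) → Hist) (W : Set (ℕ → ℝ)) (κ E₀ Gi : ℝ) : Prop :=
  (InsOpModel.ofStep M Ins).InsBoundA W κ E₀ Gi

/-- L09 (W3, ONE-RUN SIZE of a linear insertion, consumed form): `StepModel.InsertionDampedNat` BY NAME; produced from
`L09aff ∧ L09blind ∧ L09hom ∧ L09unit` by `insertionDampedNat_of_affine ∘ sizeDampedNat_of_scaleBound`; the structural three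
BY CONSTRUCTION from `InsertionLinearClass.LinearInsertion` (row O1-c), the level = O3 (WALL, c6). [folklore] -/
abbrev L09 (W : Set (ℕ → ℝ)) (κ c ω : ℝ) : Prop := M.InsertionDampedNat W κ c ω

/-- L09aff: `StepModel.InsAffine` BY NAME. [folklore] -/
abbrev L09aff (W : Set (ℕ → ℝ)) : Prop := M.InsAffine W

/-- L09blind: `StepModel.InsBlind` BY NAME. [folklore] -/
abbrev L09blind (W : Set (ℕ → ℝ)) : Prop := M.InsBlind W

/-- L09hom: `StepModel.InsHomog` BY NAME. [folklore] -/
abbrev L09hom (W : Set (ℕ → ℝ)) : Prop := M.InsHomog W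

/-- L09unit (W3 single-scale term, displayed binder — c3, O3 WALL): `StepModel.InsScaleBound` BY NAME. [folklore] -/
abbrev L09unit (W : Set (ℕ → ℝ)) (κ E₁ c ω : ℝ) : Prop := M.InsScaleBound W κ E₁ c ω

/-- `L01` unfolds to the tree shape (definitional; recorded once so the convention is visible in the kernel). [folklore] -/
theorem L01_iff (EA : Functional C C.BgA) (W : Set (ℕ → ℝ)) : L01 M EA W ↔ M.RepresentsA EA W := Iff.rfl

/-- `L04` unfolds to the tree shape. [folklore] -/
theorem L04_iff (W : Set (ℕ → ℝ)) (κ Λ ρ₀ : ℝ) : L04 M W κ Λ ρ₀ ↔ M.DataLipschitz W κ Λ ρ₀ := Iff.rfl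

end LeafIds

/-! ## §2 The bookkeeping faces: leaves ⟹ NE5, BY NAME (END faces E1, E1′ of the DAG) -/

section Faces

variable {C : Carriers} {Op Hist : Type*} [NormedAddCommGroup Op] [NormedSpace ℂ Op] [NormedAddCommGroup Hist]
  [NormedSpace ℂ Hist] (M : StepModel C Op Hist)

/-- **E1 WITH THE BINDERS NAMED BY LEAF ID.**  L01 L02 L03 (MI-R) · L04 (W2) · L05 L06 (levels) · L07 (W1) · L08 (W4) · L09 (W3)
· L10 = `hnear` ∧ `hfirst` (reach) · L11 = `hsmall` (smallness, SHARP: `T4InputCauchyRateSharp.sharp_ne5_iff`) + signs ⟹ NE5 at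
every `θ′ ∈ [θ, 1]` with constant `(Λ(δ + δ′) + B)(θ′ − ω)/(θ′ − (ω + Λc))`.  Proof = `StepModel.ne5_at_of_stepModel_lip_nat`
BY NAME. [folklore] -/
theorem ne5_of_leaves {EA : Functional C C.BgA} {EB : Functional C C.BgB} {W : Set (ℕ → ℝ)}
    {κ Λ EA₀ E₀ δ δ' θ θ' c ω ρ₀ B : ℝ} {k₀ : ℕ} (l01 : L01 M EA W) (l02 : L02 M EB W) (l03 : L03 M EB W)
    (l04 : L04 M W κ Λ ρ₀) (l05 : L05 EA W EA₀ κ) (l06 : L06 EB W E₀ κ) (l07 : L07 M W δ θ) (l08 : L08 M W κ E₀ δ' θ)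
    (l09 : L09 M W κ c ω) (hΛ : 0 ≤ Λ) (hδ : 0 ≤ δ + δ') (hθ : 0 ≤ θ) (hθθ' : θ ≤ θ') (hθ'1 : θ' ≤ 1) (hc : 0 ≤ c)
    (hω : 0 < ω) (l10near : (δ + δ') * θ ^ k₀ + c * (EA₀ + E₀) / (1 - ω) ≤ ρ₀) (hB : 0 ≤ B)
    (l10first : ∀ k < k₀, EA₀ + E₀ ≤ B * θ ^ k) (l11 : ω + Λ * c < θ') :
    NE5 EA EB W κ θ' ((Λ * (δ + δ') + B) * (θ' - ω) / (θ' - (ω + Λ * c))) :=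
  M.ne5_at_of_stepModel_lip_nat l01 l02 l03 l04 l05 l06 l07 l08 l09 hΛ hδ hθ hθθ' hθ'1 hc hω l10near hB l10first l11

/-- **E1′ WITH THE BINDERS NAMED BY LEAF ID — every wall in its most primitive typed form**: L04op ∧ L04hist for W2, L09aff ∧
L09blind ∧ L09hom ∧ L09unit for W3, `Λ = G/(1 − ρ₀)`.  Proof = `StepModel.ne5_at_of_stepModel_fibre_scale_nat` BY NAME.
[folklore] -/
theorem ne5_of_leaves_fibre {EA : Functional C C.BgA} {EB : Functional C C.BgB} {W : Set (ℕ → ℝ)}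
    {κ G EA₀ E₀ E₁ δ δ' θ θ' c ω ρ₀ B : ℝ} {k₀ : ℕ} (l01 : L01 M EA W) (l02 : L02 M EB W) (l03 : L03 M EB W)
    (l04op : L04op M W κ G) (l04hist : L04hist M W κ G) (l05 : L05 EA W EA₀ κ) (l06 : L06 EB W E₀ κ)
    (l07 : L07 M W δ θ) (l08 : L08 M W κ E₀ δ' θ) (l09aff : L09aff M W) (l09blind : L09blind M W) (l09hom : L09hom M W)
    (l09unit : L09unit M W κ E₁ c ω) (hE₁ : 0 < E₁) (hG : 0 ≤ G) (hδ : 0 ≤ δ + δ') (hθ : 0 ≤ θ) (hθθ' : θ ≤ θ')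
    (hθ'1 : θ' ≤ 1) (hc : 0 ≤ c) (hω : 0 < ω) (hρ₀ : ρ₀ < 1)
    (l10near : (δ + δ') * θ ^ k₀ + c * (EA₀ + E₀) / (1 - ω) ≤ ρ₀) (hB : 0 ≤ B)
    (l10first : ∀ k < k₀, EA₀ + E₀ ≤ B * θ ^ k) (l11 : ω + G / (1 - ρ₀) * c < θ') :
    NE5 EA EB W κ θ' ((G / (1 - ρ₀) * (δ + δ') + B) * (θ' - ω) / (θ' - (ω + G / (1 - ρ₀) * c))) :=
  M.ne5_at_of_stepModel_fibre_scale_nat l01 l02 l03 l04op l04hist l05 l06 l07 l08 l09aff l09blind l09hom l09unit hE₁ hG hδ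
    hθ hθθ' hθ'1 hc hω hρ₀ l10near hB l10first l11

end Faces

/-! ## §3 The most-reduced END face E5 with the binders named by leaf id (W1 ∕ W4 PRODUCED; rows NE2 ∕ NE3 displayed) -/

section Perturbed

variable {ι : ℕ → Type*} [∀ k, Fintype (ι k)] [∀ k, DecidableEq (ι k)]
variable {Jx : Type*} {D : (k : ℕ) → Matrix (ι k) (ι k) ℂ} {A : (k : ℕ) → Matrix (ι k) (ι (k + 1)) ℂ}
  {Jinj : (k : ℕ) → Matrix (ι (k + 1)) (ι k) ℂ} {F : (k : ℕ) → Matrix (ι k) (ι k) ℂ} {r κP : ℝ} {e₀ e₁ f : ℕ → ℝ}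
  {e₂ : Jx → ℕ → ℝ} {P : Jx → (k : ℕ) → Matrix (ι k) (ι k) ℂ} {C₀ C₁ C₂ Cf : ℝ} {t : ℂ}
variable {C : Carriers} {Op Hist : Type*} [NormedAddCommGroup Op] [NormedSpace ℂ Op] [NormedAddCommGroup Hist]
  [NormedSpace ℂ Hist] [CompleteSpace Hist] (M : StepModel C Op Hist)

/-- L07r (reading-op, minimiser split, IDENTIFICATION + norm comparison): `OutputRateTowerSocket.ReadsTowerMid M (fun _ ↦ A)
(pertTower D P t) r W cR tow opMid` BY NAME.  Row O4-r. [folklore] -/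
abbrev L07r (W : Set (ℕ → ℝ)) (cR : ℝ) (tow : ℕ → (ℕ → ℝ) → C.BgB → Jx) (opMid : (ℕ → ℝ) → C.BgB → ℕ → Op) : Prop :=
  ReadsTowerMid M (fun _ : Jx => A) (pertTower D P t) r W cR tow opMid

/-- L12 (NE2-inst, row NE2's TYPED RESIDUAL per background index, displayed binder — c3; NOT this swarm's):
`BackgroundResolventTower.PerturbationLaws D (P j) Jinj κP (e₂ j)` for every `j` BY NAME. [folklore] -/
abbrev L12 (D : (k : ℕ) → Matrix (ι k) (ι k) ℂ) (P : Jx → (k : ℕ) → Matrix (ι k) (ι k) ℂ)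
    (Jinj : (k : ℕ) → Matrix (ι (k + 1)) (ι k) ℂ) (κP : ℝ) (e₂ : Jx → ℕ → ℝ) : Prop :=
  ∀ j, PerturbationLaws D (P j) Jinj κP (e₂ j)

/-- **E5 WITH THE BINDERS NAMED BY LEAF ID** (`OutputRateTowerInstance.ne5_at_of_perturbed_split_readsIns_nat` BY NAME): row NE2's
tower inputs (`hfree` = U = 1 THEOREM inputs, `l12` = the per-background `PerturbationLaws`, defect constants at rate `θ₂ ≤ θ`,
coupling `‖t‖κP < 1`), L07r, the margin floor, the background-Lipschitz leg with row NE3's `LocalRate` (`hR`), then L01–L03,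
L04, L05∕L06, L08r, L08env ∧ L08bdA, reach `hreach`, L09, L10 (`l10near`, `l10first`), L11 (`l11`). [folklore] -/
theorem ne5_of_leaves_perturbed (Ins : ℕ → Op → (C.Dom → ℝ) → Hist) {W : Set (ℕ → ℝ)} {cR r₀ Λb Cm δ θ₂ : ℝ}
    {tow : ℕ → (ℕ → ℝ) → C.BgB → Jx} (opMid : (ℕ → ℝ) → C.BgB → ℕ → Op) (dist : ℕ → (ℕ → ℝ) → C.BgB → ℝ)
    {ιR XR : Type*} (R : Readings ιR XR) {EA : Functional C C.BgA} {EB : Functional C C.BgB}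
    {κ Λ EA₀ E₀ Gi θ θ' c ω ρ₀ ρ₁ B : ℝ} {k₀ k₁ : ℕ} (hr : 0 < r) (hfree : FreeTowerLaws D A Jinj F r e₀ e₁ f)
    (l12 : L12 D P Jinj κP e₂) (h₀ : ∀ k, e₀ k ≤ C₀ * θ₂ ^ k) (h₁ : ∀ k, e₁ k ≤ C₁ * θ₂ ^ k)
    (h₂ : ∀ j k, e₂ j k ≤ C₂ * θ₂ ^ k) (hf : ∀ k, f k ≤ Cf * θ₂ ^ k) (hC₀ : 0 ≤ C₀) (hC₁ : 0 ≤ C₁) (hC₂ : 0 ≤ C₂)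
    (hCf : 0 ≤ Cf) (ht : ‖t‖ * κP < 1) (l07r : L07r (A := A) (D := D) (P := P) (t := t) (r := r) M W cR tow opMid)
    (hcR : 0 ≤ cR) (hθ₂ : 0 ≤ θ₂) (hθ₂θ : θ₂ ≤ θ) (hfl : ∀ k, r₀ ≤ M.rOp k) (hr₀ : 0 < r₀)
    (hLip : ∀ k, ∀ g ∈ W, ∀ (U : C.BgB), ‖opMid g U k - M.opB g U k‖ ≤ Λb * dist k g U * M.rOp k) (hΛb : 0 ≤ Λb)
    (hR : LocalRate R Cm θ) (hCm : 0 ≤ Cm)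
    (hdom : ∀ k, ∀ g ∈ W, ∀ (U : C.BgB), ∃ V ∈ R.dom, ∃ x : XR, dist k g U ≤ |R.loc (k + 1) V x - R.loc k V x|)
    (hδ : cR * Cpert κP C₀ C₁ C₂ Cf t / r₀ + Λb * Cm = δ) (l01 : L01 M EA W) (l02 : L02 M EB W) (l03 : L03 M EB W)
    (l04 : L04 M W κ Λ ρ₀) (l05 : L05 EA W EA₀ κ) (l06 : L06 EB W E₀ κ) (l08r : L08r M Ins W)
    (l08env : L08env M Ins W κ E₀ Gi) (l08bdA : L08bdA M Ins W κ E₀ Gi) (hGi : 0 ≤ Gi) (hρ₁ : ρ₁ < 1)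
    (hreach : δ * θ ^ k₁ ≤ ρ₁) (l09 : L09 M W κ c ω) (hΛ : 0 ≤ Λ) (hθ0 : 0 < θ) (hθθ' : θ ≤ θ') (hθ'1 : θ' ≤ 1)
    (hc : 0 ≤ c) (hω : 0 < ω)
    (l10near : (δ + (Gi * δ / (1 - ρ₁) + 2 * Gi / θ ^ k₁)) * θ ^ k₀ + c * (EA₀ + E₀) / (1 - ω) ≤ ρ₀) (hB : 0 ≤ B)
    (l10first : ∀ k < k₀, EA₀ + E₀ ≤ B * θ ^ k) (l11 : ω + Λ * c < θ') :
    NE5 EA EB W κ θ'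
      ((Λ * (δ + (Gi * δ / (1 - ρ₁) + 2 * Gi / θ ^ k₁)) + B) * (θ' - ω) / (θ' - (ω + Λ * c))) :=
  ne5_at_of_perturbed_split_readsIns_nat M Ins opMid dist R hr hfree l12 h₀ h₁ h₂ hf hC₀ hC₁ hC₂ hCf ht l07r hcR hθ₂ hθ₂θ
    hfl hr₀ hLip hΛb hR hCm hdom hδ l01 l02 l03 l04 l05 l06 l08r l08env l08bdA hGi hρ₁ hreach l09 hΛ hθ0 hθθ' hθ'1 hc hω
    l10near hB l10first l11

end Perturbed

end Summit.QuantumFields.BalabanUV.T4Continuum.Spine.NE5
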